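import Literature.NumberTheory.Transcendental.NesterenkoBricks
import Literature.NumberTheory.Transcendental.TaylorCoeffPadic
import Mathlib.Data.Rat.Floor
import HarnessLib

/-!
# Nesterenko's elementary bricks, II: the reciprocal brick and Zudilin's Lemmas 17–18

Topic `Literature/NumberTheory/Transcendental`. Continuation of `NesterenkoBricks.lean`.

* `recipBrick a m t = (m-1)! / ((t+a)(t+a+1)⋯(t+a+m-1))` — Zudilin's brick `R(a,b;t)` for
  `b = a + m > a` ([Zudilin2004, (7.3), second case]), and `recipBrickReg a m k`, the rational
  function `R(t)(t+k)` with its removable singularity at `t = -k` removed (the form in which the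
  reciprocal bricks enter the Leibniz rule in [Zudilin2004, Lemmas 3, 16, 18, 19]);
  `recipBrickReg_eq` identifies the two away from `t = -k`.
* `polyBrick_isDOrd` — **[Zudilin2004, Lemma 17]**: for the polynomial brick
  `R(t) = R(a,b;t)`, `a = b + m`, every integer `k` and prime `p` with `m < p²`:
  `ord_p R^{(j)}(-k) ≥ -j + ⌊(a-1-k)/p⌋ - ⌊(b-1-k)/p⌋ - ⌊(a-b)/p⌋` ((7.4), first form).
* `recipBrickReg_isDOrd` — **[Zudilin2004, Lemma 18]**: for the reciprocal brick,
  `a₀ ≤ a < b ≤ b₀`, `a₀ ≤ k < b₀`, `p > √(b₀-a₀-1)`: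
  `ord_p (R(t)(t+k))^{(j)}|_{t=-k} ≥ -j + ⌊(b-a-1)/p⌋ - ⌊(k-a)/p⌋ - ⌊(b-1-k)/p⌋` ((7.7)).

Proofs. Instead of the logarithmic-derivative induction of [Zudilin2004, pp. 17–18] we apply
the product rule for `IsDOrd` (`TaylorCoeffPadic.lean`) factor by factor: at `t = -k` a linear
factor `t + c` has `IsDOrd p [p ∣ c-k]` (`isDOrd_add_const`), an inverse factor `(t+c)⁻¹`,
`c ≠ k`, `ord_p(c-k) ≤ 1`, has `IsDOrd p (-[p ∣ c-k])` (`isDOrd_inv_add_const`), and a constant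
`C` has `IsDOrd p (ord_p C)`. Summing the exponents gives the number of multiples of `p` in an
interval of integers, i.e. a difference of two integer parts (`card_filter_dvd_range`), and
Legendre's formula for `ord_p m!`; the identity `⌊(a-1-k)/p⌋ = -⌊(k-a)/p⌋ - 1` ((7.5)) converts
between the two printed forms.

Remark on the hypothesis of Lemma 17. [Zudilin2004] states Lemma 17 for `p > √(a₀-b₀-1)` with
`b₀ ≤ b < a ≤ a₀`; what the proof uses (and what we assume) is `a - b < p²` (needed for
`ord_p (a-b)! = ⌊(a-b)/p⌋`); the printed hypothesis allows the boundary case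
`a - b = a₀ - b₀ = p²`, where (7.4) fails for `j = 1` (e.g. `p = 2`, `a - b = 4`). In the
application ([Zudilin2004, Lemma 19]) `p² > h₀` exceeds every `a - b`, so nothing is lost.
Everything here is PROVED (no named facts).

## References

* [Zudilin2004] W. Zudilin, *Arithmetic of linear forms involving odd zeta values*, J. Théor.
  Nombres Bordeaux 16 (2004), 251–291, §7: (7.3), (7.5), Lemma 17 with (7.4), Lemma 18 with (7.7).
-/

noncomputable section

open Finset Filter Literature.Analysis.Calculus
open scoped Nat

namespace Literature.NumberTheory.Transcendental

/-! ### Integer parts -/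

/-- `⌊(z-1)/p⌋ = ⌊z/p⌋ - [p ∣ z]` for integers. [folklore] -/
theorem Int.sub_one_ediv_eq (z : ℤ) {p : ℤ} (hp : 0 < p) :
    (z - 1) / p = z / p - if p ∣ z then 1 else 0 := by
  have hq := (Int.ediv_eq_iff_of_pos hp).1 (rfl : z / p = z / p)
  rw [Int.ediv_eq_iff_of_pos hp]
  split_ifs with h
  · obtain ⟨c, hc⟩ := h
    have : z / p = c := by rw [hc, Int.mul_ediv_cancel_left _ hp.ne']
    rw [this]
    constructor <;> nlinarith
  · have hne : z / p * p ≠ z := fun h' => h ⟨z / p, by rw [mul_comm] at h'; exact h'.symm⟩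
    have hlt : z / p * p < z := lt_of_le_of_ne hq.1 hne
    constructor <;> linarith

/-- `⌊(-z-1)/p⌋ = -⌊z/p⌋ - 1` for integers ([Zudilin2004, (7.5)]). [cite: Zudilin2004, §7 (7.5)] -/
theorem Int.neg_sub_one_ediv_eq (z : ℤ) {p : ℤ} (hp : 0 < p) : (-z - 1) / p = -(z / p) - 1 := by
  have hq := (Int.ediv_eq_iff_of_pos hp).1 (rfl : z / p = z / p)
  rw [Int.ediv_eq_iff_of_pos hp]
  constructor <;> nlinarith

/-- Number of multiples of `p` among `u, u+1, …, u+m-1`: `⌊(u+m-1)/p⌋ - ⌊(u-1)/p⌋`. [folklore] -/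
theorem card_filter_dvd_range (u : ℤ) (m : ℕ) {p : ℤ} (hp : 0 < p) :
    (((range m).filter fun l : ℕ => p ∣ u + l).card : ℤ) = (u + m - 1) / p - (u - 1) / p := by
  induction m with
  | zero => simp
  | succ m ih =>
    rw [range_add_one, filter_insert]
    have hnot : m ∉ (range m).filter fun l : ℕ => p ∣ u + l := by simp
    have h2 := Int.sub_one_ediv_eq (u + m) hp
    have e : (u + ((m + 1 : ℕ) : ℤ) - 1) = u + m := by push_cast; ring
    rw [e]
    split_ifs with h
    · rw [card_insert_of_notMem hnot, Nat.cast_succ, ih]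
      rw [if_pos h] at h2
      linarith
    · rw [ih]
      rw [if_neg h] at h2
      linarith

/-- Legendre, lower bound: `⌊n/p⌋ ≤ ord_p n!`. [folklore] -/
theorem div_le_padicValNat_factorial (p n : ℕ) [hp : Fact p.Prime] : n / p ≤ padicValNat p n ! := by
  rw [padicValNat_factorial (b := Nat.log p n + 1) (Nat.lt_succ_self _)]
  by_cases h : 1 < Nat.log p n + 1
  · have hmem : 1 ∈ Ico 1 (Nat.log p n + 1) := mem_Ico.2 ⟨le_rfl, h⟩
    simpa using single_le_sum (f := fun i => n / p ^ i) (fun _ _ => Nat.zero_le _) hmem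
  · have hlog : Nat.log p n = 0 := by omega
    have hn : n < p := (Nat.log_eq_zero_iff.1 hlog).resolve_right (fun h' => by
      have := hp.out.one_lt; omega)
    simp [Nat.div_eq_of_lt hn]

/-- Legendre for `n < p²`: `ord_p n! = ⌊n/p⌋`. [folklore] -/
theorem padicValNat_factorial_of_lt_sq (p n : ℕ) [hp : Fact p.Prime] (h : n < p ^ 2) :
    padicValNat p n ! = n / p := by
  have hlog : Nat.log p n < 2 := by
    rcases Nat.eq_zero_or_pos n with rfl | hn
    · simp
    · exact (Nat.log_lt_iff_lt_pow hp.out.one_lt hn.ne').2 h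
  rw [padicValNat_factorial (b := 2) hlog]
  simp

/-! ### Linear and inverse-linear factors -/

/-- At `t = -k`, the linear factor `t + c` (`c ∈ ℤ`) satisfies `IsDOrd p e N` with
`e = 1` if `p ∣ c - k` and `e = 0` otherwise. [folklore] -/
theorem isDOrd_add_const (p : ℕ) [hp : Fact p.Prime] (c k : ℤ) (N : ℕ) :
    IsDOrd p (if (p : ℤ) ∣ c - k then 1 else 0) N (fun t : ℚ => t + c) (-(k : ℚ)) := by
  refine ⟨contDiffAt_id.add contDiffAt_const, fun j _ => ?_⟩
  have hder := iteratedDeriv_affine 1 (c : ℚ) (-(k : ℚ)) j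
  simp only [one_mul] at hder
  rw [hder]
  rcases j with _ | _ | j
  · simp only [if_true, Nat.cast_zero, sub_zero]
    split_ifs with hdvd
    · by_cases h0 : (c : ℚ) - k = 0
      · exact Or.inl (by rw [← h0]; ring)
      · refine Or.inr ?_
        have hck : c - k ≠ 0 := fun h => h0 (by exact_mod_cast h)
        have h1 : (1 : ℕ) ≤ padicValInt p (c - k) :=
          ((padicValInt_dvd_iff 1 (c - k)).1 (by simpa using hdvd)).resolve_left hck
        rw [show (-(k : ℚ) + c) = ((c - k : ℤ) : ℚ) by push_cast; ring, padicValRat.of_int]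
        exact_mod_cast h1
    · rw [show (-(k : ℚ) + c) = ((c - k : ℤ) : ℚ) by push_cast; ring]
      exact PadicOrdGe.of_int _
  · simp only [Nat.succ_ne_zero, if_false, if_true]
    refine Or.inr ?_
    rw [padicValRat.one]
    split_ifs <;> norm_num
  · simp only [Nat.succ_ne_zero, if_false]
    have : (j + 1 + 1 : ℕ) ≠ 1 := by omega
    rw [if_neg this]
    exact PadicOrdGe.zero _

/-- At `t = -k`, the inverse factor `(t + c)⁻¹` (`c ∈ ℤ`, `c ≠ k`, `ord_p (c-k) ≤ 1`) satisfies
`IsDOrd p e N` with `e = -1` if `p ∣ c - k` and `e = 0` otherwise. [folklore] -/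
theorem isDOrd_inv_add_const (p : ℕ) [hp : Fact p.Prime] {c k : ℤ} (hck : c ≠ k)
    (hv : padicValInt p (c - k) ≤ 1) (N : ℕ) :
    IsDOrd p (if (p : ℤ) ∣ c - k then -1 else 0) N (fun t : ℚ => (t + c)⁻¹) (-(k : ℚ)) := by
  have hne : (-(k : ℚ)) + c ≠ 0 := by
    rw [show (-(k : ℚ) + c) = ((c - k : ℤ) : ℚ) by push_cast; ring]
    exact_mod_cast sub_ne_zero.2 hck
  refine ⟨contDiffAt_inv_add_const hne, fun j _ => ?_⟩
  rw [iteratedDeriv_eq_factorial_mul_divDeriv, divDeriv_inv_add_const j hne, div_eq_mul_inv,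
    show (-(k : ℚ) + c) = ((c - k : ℤ) : ℚ) by push_cast; ring]
  -- `ord_p (j! · (-1)^j · ((c-k)^{j+1})⁻¹) = ord_p j! - (j+1) ord_p (c-k)`
  have h3 : PadicOrdGe p (-((j + 1 : ℕ) * padicValRat p ((c - k : ℤ) : ℚ)))
      ((((c - k : ℤ) : ℚ) ^ (j + 1))⁻¹) := by
    refine Or.inr (le_of_eq ?_)
    rw [padicValRat.inv, padicValRat.pow]
  have h1 : PadicOrdGe p 0 ((j ! : ℚ)) := PadicOrdGe.of_nat (p := p) (j !)
  have h2 : PadicOrdGe p 0 ((-1 : ℚ) ^ j) := by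
    have := PadicOrdGe.of_int (p := p) ((-1) ^ j)
    simpa using this
  have := h1.mul (h2.mul h3)
  refine this.mono ?_
  rw [padicValRat.of_int]
  split_ifs with hdvd
  · have h1' : (1 : ℕ) ≤ padicValInt p (c - k) :=
      ((padicValInt_dvd_iff 1 (c - k)).1 (by simpa using hdvd)).resolve_left (sub_ne_zero.2 hck)
    have : padicValInt p (c - k) = 1 := le_antisymm hv h1'
    rw [this]; push_cast; omega
  · have : padicValInt p (c - k) = 0 := padicValInt.eq_zero_of_not_dvd hdvd
    rw [this]; push_cast; omega

/-! ### The reciprocal brick -/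

/-- **Nesterenko's reciprocal brick** `recipBrick a m t = (m-1)! / ((t+a)(t+a+1)⋯(t+a+m-1))`,
i.e. Zudilin's `R(a,b;t) = (b-a-1)!/((t+a)⋯(t+b-1))` for `b = a + m > a` ([Zudilin2004, (7.3),
second case]). [cite: Zudilin2004, §7 (7.3)] -/
def recipBrick (a : ℤ) (m : ℕ) (t : ℚ) : ℚ :=
  ((m - 1)! : ℚ) * ∏ l ∈ range m, (t + ((a + (l : ℤ) : ℤ) : ℚ))⁻¹

/-- The rational function `R(t)(t+k)` for the reciprocal brick `R = recipBrick a m`, written as a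
product that is regular at `t = -k`: the factor `(t + k)⁻¹` is cancelled when `-k` is a pole
(`a ≤ k < a+m`), and the factor `t + k` is kept otherwise. [cite: Zudilin2004, §7 Lemma 18] -/
def recipBrickReg (a : ℤ) (m : ℕ) (k : ℤ) (t : ℚ) : ℚ :=
  ((m - 1)! : ℚ) * (∏ l ∈ (range m).filter (fun l : ℕ => a + (l : ℤ) ≠ k), (t + ((a + (l : ℤ) : ℤ) : ℚ))⁻¹) *
    (if a ≤ k ∧ k < a + m then 1 else (t + k))

/-- Away from `t = -k`: `recipBrickReg a m k t = recipBrick a m t · (t + k)`. [folklore] -/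
theorem recipBrickReg_eq (a : ℤ) (m : ℕ) (k : ℤ) {t : ℚ} (ht : t + k ≠ 0) :
    recipBrickReg a m k t = recipBrick a m t * (t + k) := by
  unfold recipBrickReg recipBrick
  by_cases hk : a ≤ k ∧ k < a + m
  · rw [if_pos hk]
    have hsplit := prod_filter_mul_prod_filter_not (range m) (fun l : ℕ => a + (l : ℤ) ≠ k)
      (fun l : ℕ => (t + ((a + (l : ℤ) : ℤ) : ℚ))⁻¹)
    -- the complementary filter is the singleton `{(k - a).toNat}`
    have hcomp : (range m).filter (fun l : ℕ => ¬ a + (l : ℤ) ≠ k) = {(k - a).toNat} := by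
      ext l
      simp only [mem_filter, mem_range, not_not, mem_singleton]
      omega
    rw [← hsplit, hcomp, prod_singleton]
    have hcast : ((a + (((k - a).toNat : ℕ) : ℤ) : ℤ) : ℚ) = k := by
      have : (a + (((k - a).toNat : ℕ) : ℤ) : ℤ) = k := by omega
      exact_mod_cast this
    rw [hcast, mul_one, mul_assoc, mul_assoc, inv_mul_cancel₀ ht, mul_one]
  · rw [if_neg hk]
    have hall : (range m).filter (fun l : ℕ => a + (l : ℤ) ≠ k) = range m := by
      refine filter_true_of_mem fun l hl => ?_
      have := mem_range.1 hl
      omega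
    rw [hall]

/-! ### Lemma 17 -/

/-- **[Zudilin2004, Lemma 17]** (sharp `p`-adic order of the polynomial brick), in the count form:
at `t = -k` the brick `R(t) = (t+b)⋯(t+b+m-1)/m!` has
`ord_p R^{(j)}(-k) ≥ -j + #{l < m : p ∣ b+l-k} - ord_p m!`. [cite: Zudilin2004, §7 Lemma 17] -/
theorem polyBrick_isDOrd_count (p : ℕ) [hp : Fact p.Prime] (b : ℤ) (m : ℕ) (k : ℤ) (N : ℕ) :
    IsDOrd p ((((range m).filter fun l : ℕ => (p : ℤ) ∣ b + l - k).card : ℤ) - padicValNat p m !)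
      N (polyBrick b m) (-(k : ℚ)) := by
  have hfac := IsDOrd.prod (p := p) (N := N) (x := (-(k : ℚ))) (range m)
    (E := fun l : ℕ => if (p : ℤ) ∣ (b + l) - k then 1 else 0)
    (F := fun (l : ℕ) (t : ℚ) => t + ((b + l : ℤ) : ℚ)) (fun l _ => isDOrd_add_const p (b + l) k N)
  have hconst : PadicOrdGe p (-(padicValNat p m ! : ℤ)) ((m ! : ℚ))⁻¹ := by
    refine Or.inr (le_of_eq ?_)
    rw [padicValRat.inv, padicValRat.of_nat]
  have h := hfac.const_mul hconst
  have hsum : ∑ l ∈ range m, (if (p : ℤ) ∣ b + l - k then (1 : ℤ) else 0)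
      = (((range m).filter fun l : ℕ => (p : ℤ) ∣ b + l - k).card : ℤ) := by
    rw [sum_boole]
  refine (h.mono (le_of_eq ?_)).congr (Eventually.of_forall fun t => ?_)
  · rw [hsum]; ring
  · show ((m ! : ℚ))⁻¹ * ∏ l ∈ range m, (t + ((b + l : ℤ) : ℚ)) = polyBrick b m t
    unfold polyBrick
    rw [div_eq_inv_mul]
    congr 1
    exact prod_congr rfl fun l _ => by push_cast; ring

/-- **[Zudilin2004, Lemma 17, (7.4)]**: for `R(t) = R(a,b;t) = (t+b)⋯(t+a-1)/(a-b)!` with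
`a = b + m`, an integer `k`, and a prime `p` with `a - b = m < p²` (see the module docstring for
this form of the hypothesis), `ord_p R^{(j)}(-k) ≥ -j + ⌊(a-1-k)/p⌋ - ⌊(b-1-k)/p⌋ - ⌊(a-b)/p⌋`
for all `j`. Integer parts are integer divisions `Int.ediv` (= `⌊·⌋` of the rational quotient,
`Rat.floor_intCast_div_natCast`). [cite: Zudilin2004, §7 Lemma 17 (7.4)] -/
theorem polyBrick_isDOrd (p : ℕ) [hp : Fact p.Prime] (b : ℤ) (m : ℕ) (hm : m < p ^ 2) (k : ℤ)
    (N : ℕ) :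
    IsDOrd p ((b + m - 1 - k) / p - (b - 1 - k) / p - (m : ℤ) / p) N (polyBrick b m) (-(k : ℚ)) := by
  have h := polyBrick_isDOrd_count p b m k N
  have hp0 : (0 : ℤ) < p := by exact_mod_cast hp.out.pos
  have hcount := card_filter_dvd_range (b - k) m hp0
  have hcongr : ((range m).filter fun l : ℕ => (p : ℤ) ∣ b + l - k)
      = (range m).filter fun l : ℕ => (p : ℤ) ∣ b - k + l := by
    refine filter_congr fun l _ => ?_
    rw [show b + l - k = b - k + l by ring]
  rw [hcongr, hcount] at h
  rw [padicValNat_factorial_of_lt_sq p m hm] at h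
  refine h.mono (le_of_eq ?_)
  have e1 : b - k + m - 1 = b + m - 1 - k := by ring
  have e2 : b - k - 1 = b - 1 - k := by ring
  rw [e1, e2]
  push_cast
  ring

/-! ### Lemma 18 -/

/-- **[Zudilin2004, Lemma 18]** in the count form: for the reciprocal brick `R = recipBrick a m`
and an integer `k` such that `ord_p (a+l-k) ≤ 1` whenever `l < m`, `a + l ≠ k` (true when
`|a+l-k| < p²`), the regularised product `R(t)(t+k)` satisfies at `t = -k`:
`ord_p (R(t)(t+k))^{(j)} ≥ -j + ord_p (m-1)! - #{l < m : a+l ≠ k, p ∣ a+l-k} + [¬(a ≤ k < a+m)]`.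
[cite: Zudilin2004, §7 Lemma 18] -/
theorem recipBrickReg_isDOrd_count (p : ℕ) [hp : Fact p.Prime] (a : ℤ) (m : ℕ) (k : ℤ)
    (hv : ∀ l ∈ range m, a + (l : ℤ) ≠ k → padicValInt p (a + l - k) ≤ 1) (N : ℕ) :
    IsDOrd p ((padicValNat p (m - 1)! : ℤ)
        - ((((range m).filter fun l : ℕ => a + (l : ℤ) ≠ k).filter
            fun l : ℕ => (p : ℤ) ∣ a + l - k).card : ℤ)
        + (if a ≤ k ∧ k < a + m then 0 else 1))
      N (recipBrickReg a m k) (-(k : ℚ)) := by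
  set S := (range m).filter fun l : ℕ => a + (l : ℤ) ≠ k with hS
  have hfac := IsDOrd.prod (p := p) (N := N) (x := (-(k : ℚ))) S
    (E := fun l : ℕ => if (p : ℤ) ∣ (a + l) - k then -1 else 0)
    (F := fun (l : ℕ) (t : ℚ) => (t + ((a + (l : ℤ) : ℤ) : ℚ))⁻¹) (fun l hl => by
      have hl' := (mem_filter.1 hl)
      exact isDOrd_inv_add_const p hl'.2 (hv l hl'.1 hl'.2) N)
  have hconst : PadicOrdGe p (padicValNat p (m - 1)! : ℤ) (((m - 1)! : ℚ)) := by
    refine Or.inr (le_of_eq ?_)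
    rw [padicValRat.of_nat]
  have hlast : IsDOrd p (if a ≤ k ∧ k < a + m then 0 else 1) N
      (fun t : ℚ => if a ≤ k ∧ k < a + m then (1 : ℚ) else t + k) (-(k : ℚ)) := by
    split_ifs with hk
    · exact IsDOrd.one N _
    · have := isDOrd_add_const p k k N
      simpa using this
  have h := (hfac.const_mul hconst).mul hlast
  have hsum : ∑ l ∈ S, (if (p : ℤ) ∣ a + l - k then (-1 : ℤ) else 0)
      = -((S.filter fun l : ℕ => (p : ℤ) ∣ a + l - k).card : ℤ) := by
    have hneg : ∀ l : ℕ, (if (p : ℤ) ∣ a + l - k then (-1 : ℤ) else 0)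
        = -(if (p : ℤ) ∣ a + l - k then (1 : ℤ) else 0) := fun l => by
      split_ifs <;> simp
    simp_rw [hneg, sum_neg_distrib, sum_boole]
  refine (h.mono (le_of_eq ?_)).congr (Eventually.of_forall fun t => ?_)
  · rw [hsum]; ring
  · simp only [recipBrickReg, hS]

/-- **[Zudilin2004, Lemma 18, (7.7)]**: let `a, b = a + m, a₀, b₀` be integers with
`a₀ ≤ a < b ≤ b₀`, let `k` be an integer with `a₀ ≤ k < b₀`, and let `p` be a prime with
`p² > b₀ - a₀ - 1` (i.e. `p > √(b₀-a₀-1)`). Then for the reciprocal brick `R(t) = R(a,b;t)`,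
`ord_p (R(t)(t+k))^{(j)}|_{t=-k} ≥ -j + ⌊(b-a-1)/p⌋ - ⌊(k-a)/p⌋ - ⌊(b-1-k)/p⌋` for all `j`
(integer parts = `Int.ediv`). [cite: Zudilin2004, §7 Lemma 18 (7.7)] -/
theorem recipBrickReg_isDOrd (p : ℕ) [hp : Fact p.Prime] {a₀ b₀ a : ℤ} {m : ℕ} (hm : 1 ≤ m)
    (ha : a₀ ≤ a) (hb : a + m ≤ b₀) {k : ℤ} (hk₁ : a₀ ≤ k) (hk₂ : k < b₀)
    (hp2 : b₀ - a₀ - 1 < (p : ℤ) ^ 2) (N : ℕ) :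
    IsDOrd p (((m : ℤ) - 1) / p - (k - a) / p - (a + m - 1 - k) / p) N
      (recipBrickReg a m k) (-(k : ℚ)) := by
  have hp0 : (0 : ℤ) < p := by exact_mod_cast hp.out.pos
  -- hypothesis of the count form: `ord_p (a+l-k) ≤ 1` since `0 < |a+l-k| < p²`
  have hv : ∀ l ∈ range m, a + (l : ℤ) ≠ k → padicValInt p (a + l - k) ≤ 1 := by
    intro l hl hne
    have hl' := mem_range.1 hl
    by_contra hcon
    push Not at hcon
    have h2 : (2 : ℕ) ≤ padicValInt p (a + l - k) := hcon
    have hdvd : (p : ℤ) ^ 2 ∣ a + l - k := (padicValInt_dvd_iff 2 _).2 (Or.inr h2)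
    have hne0 : a + l - k ≠ 0 := sub_ne_zero.2 hne
    have habs : |a + l - k| < (p : ℤ) ^ 2 := by
      rw [abs_lt]; constructor <;> omega
    exact hne0 (Int.eq_zero_of_abs_lt_dvd hdvd habs)
  have h := recipBrickReg_isDOrd_count p a m k hv N
  -- count of multiples of `p` among `a-k, …, a+m-1-k`
  have hcount := card_filter_dvd_range (a - k) m hp0
  set T := (range m).filter fun l : ℕ => (p : ℤ) ∣ a - k + l with hT
  set S' := ((range m).filter fun l : ℕ => a + (l : ℤ) ≠ k).filter
    fun l : ℕ => (p : ℤ) ∣ a + l - k with hS'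
  -- `#S' + [a ≤ k < a+m] = #T`
  have hST : (S'.card : ℤ) + (if a ≤ k ∧ k < a + m then 1 else 0) = T.card := by
    by_cases hkr : a ≤ k ∧ k < a + m
    · rw [if_pos hkr]
      have hl0 : (k - a).toNat ∈ T := by
        rw [hT, mem_filter, mem_range]
        refine ⟨by omega, ⟨0, by omega⟩⟩
      have hS'eq : S' = T.erase (k - a).toNat := by
        ext l
        simp only [hS', hT, mem_filter, mem_range, mem_erase]
        constructor
        · rintro ⟨⟨hl, hne⟩, hd⟩
          refine ⟨by omega, hl, by rw [show a - k + l = a + l - k by ring]; exact hd⟩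
        · rintro ⟨hne, hl, hd⟩
          refine ⟨⟨hl, by omega⟩, by rw [show a + l - k = a - k + l by ring]; exact hd⟩
      rw [hS'eq, card_erase_of_mem hl0]
      have : 1 ≤ T.card := card_pos.2 ⟨_, hl0⟩
      omega
    · rw [if_neg hkr, add_zero]
      have hS'eq : S' = T := by
        ext l
        simp only [hS', hT, mem_filter, mem_range]
        constructor
        · rintro ⟨⟨hl, -⟩, hd⟩
          exact ⟨hl, by rw [show a - k + l = a + l - k by ring]; exact hd⟩
        · rintro ⟨hl, hd⟩
          exact ⟨⟨hl, by omega⟩, by rw [show a + l - k = a - k + l by ring]; exact hd⟩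
      rw [hS'eq]
  refine h.mono ?_
  have hleg : ((m - 1) / p : ℕ) ≤ padicValNat p (m - 1)! := div_le_padicValNat_factorial p (m - 1)
  have hleg' : (((m : ℤ) - 1) / p) ≤ (padicValNat p (m - 1)! : ℤ) := by
    have : (((m - 1 : ℕ) : ℤ) / (p : ℤ)) = (((m - 1) / p : ℕ) : ℤ) := by simp
    rw [show ((m : ℤ) - 1) = ((m - 1 : ℕ) : ℤ) by omega, this]
    exact_mod_cast hleg
  have h75 := Int.neg_sub_one_ediv_eq (k - a) hp0
  have e1 : -(k - a) - 1 = a - k - 1 := by ring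
  rw [e1] at h75
  have e2 : a - k + m - 1 = a + m - 1 - k := by ring
  rw [e2] at hcount
  -- assemble
  have key : (S'.card : ℤ) - (if a ≤ k ∧ k < a + m then 0 else 1)
      = (a + m - 1 - k) / p + (k - a) / p := by
    have := hST
    rw [hcount, h75] at this
    split_ifs at this ⊢ with hkr <;> linarith
  linarith

end Literature.NumberTheory.Transcendental
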